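import Summits.MatrixMultiplication.MatrixMultiplication.Theorems.SoloInformedCwTwoBoundary
import HarnessLib

/-!
# The door's shadow in characteristic `2` (solo-informed, gen 25)

Ninth file of the §2n series (`SoloInformedCwTwoShadowCharTwo`; the older
`SoloInformedCwTwoCharTwo` is the unrelated digit-design file of door D6).  Over `ℂ` the door tensor `P = Σ_{σ∈𝔖₃} e_σ ≅ T_{cw,2}` degenerates to
the `21` Nurmiev normal forms `N₃, N₅, …, N₂₄` (`SoloInformedCwTwoNormalForms`), but every one of those
certificates except `N₁₉`'s has an EVEN multiplier `D`.  Here we decide most of the table when `2 = 0`: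

* `pencilDetInt` — the determinant of the first-factor slice pencil `Σ_a ν_a t(a,·,·)` of an integer
  tensor at an integer point, computable (Sarrus), with `pencilDetInt_eq_det`;
* `not_sThree_polyDegeneratesTo_of_pencilDetInt` — the landed char-`2` pencil theorem
  (`not_polyDegeneratesTo_sThree_of_two_eq_zero`: modulo `2`, `P ≡ ε` has only singular pencil
  matrices) with its hypothesis discharged by `decide` on `pencilDetInt`;
* `polyDegeneratesTo_swap₁₂` (degeneration is compatible with swapping the first two factors) and
  `sThree_swap₁₂` (`P` is symmetric), to reach classes whose first-factor pencil cubic vanishes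
  identically modulo `2` but whose second-factor pencil does not (`N₁₁ ∋ T_{U₂}`);
* **`not_sThree_polyDegeneratesTo_nurmiev_of_mem_of_two_eq_zero`**: if `2 = 0` in a nontrivial
  commutative ring `K` then `P ⋭ N_k` over `K` for the SIXTEEN classes
  `k ∈ {1,2,3,4,5,6,7,8,10,11,12,13,14,15,16,22}` (a pencil matrix with determinant `±1`);
* `sThree_polyDegeneratesTo_nurmiev_of_mem_all_rings`: `P ⊵ N_k` over EVERY commutative ring for
  `k ∈ {19, 23, 24}` (multiplier-`1` certificates; `N₂₃`, `N₂₄` are restrictions of one slice of `P`).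

Not decided in this file: `N₉, N₁₇, N₁₈, N₂₀, N₂₁` (all three pencil cubics vanish identically modulo
`2`).  Of these, `N₁₇`, `N₂₀ = ⟨2⟩ ⊕ 0` and `N₂₁ = W` are `0/1` restrictions of `P`, so below `P` over every
ring (`SoloInformedCwTwoCharTwoRestrictions`), and `N₉`, `N₁₈` are obstructed by the rank MODULO `2` of
the skew form `Ω_T = (ε⊗ε⊗ε)(T,·,·)` (`16` at `P ≡ ε`, `18` at `N₉`, `N₁₈`; exact computation, not yet
formalised).  Granting that computation, in characteristic `2` the shadow of the door is exactly
`{N₁₇, N₁₉, N₂₀, N₂₁, N₂₃, N₂₄}` — six classes against twenty-one in characteristic `0`.  In particular every class below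
the door that contains the structure tensor of a UNITAL algebra (`N₅ ∋ T_{B_{0,3}}`, `N₈ ∋ T_{ℂ×ℂ[t]/t²}`,
`N₁₀ ∋ T_{ℂ[t]/t³}`, `N₁₁ ∋ T_{U₂}`, `N₁₄ ∋ T_{ℂ[x,y]/𝔪²}`) is `2`-adically obstructed: the unit is an
invertible pencil element.
-/

namespace Summit.MatrixMultiplication.MatrixMultiplication.Theorems

open scoped BigOperators Polynomial
open Polynomial
open Literature.Computability.AlgebraicComplexity
open Literature.Barriers.MatrixMultiplication (PolyDegeneratesTo)

/-! ## A computable pencil determinant -/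

/-- Sarrus' formula for `det (Σ_a ν_a t(a,·,·))` of an integer `3 × 3 × 3` tensor (computable). -/
def pencilDetInt (t : Fin 3 → Fin 3 → Fin 3 → ℤ) (ν : Fin 3 → ℤ) : ℤ :=
  let m : Fin 3 → Fin 3 → ℤ := fun b c => ν 0 * t 0 b c + ν 1 * t 1 b c + ν 2 * t 2 b c
  m 0 0 * m 1 1 * m 2 2 - m 0 0 * m 1 2 * m 2 1 - m 0 1 * m 1 0 * m 2 2 + m 0 1 * m 1 2 * m 2 0 +
    m 0 2 * m 1 0 * m 2 1 - m 0 2 * m 1 1 * m 2 0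

/-- `pencilDetInt` is the determinant of the first-factor pencil matrix. -/
theorem pencilDetInt_eq_det (t : Fin 3 → Fin 3 → Fin 3 → ℤ) (ν : Fin 3 → ℤ) :
    pencilDetInt t ν = (Matrix.of fun b c => ∑ a, ν a * t a b c).det := by
  rw [Matrix.det_fin_three]
  simp only [Matrix.of_apply, Fin.sum_univ_three, pencilDetInt]

/-- The cast pencil matrix is the image of the integer one. -/
theorem pencilMatrix_cast (K : Type*) [CommRing K] (t : Fin 3 → Fin 3 → Fin 3 → ℤ)
    (ν : Fin 3 → ℤ) :
    (Matrix.of fun b c => ∑ a, ((ν a : ℤ) : K) * ((t a b c : ℤ) : K)) =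
      (Int.castRingHom K).mapMatrix (Matrix.of fun b c => ∑ a, ν a * t a b c) := by
  ext b c
  simp [Matrix.map_apply]

/-- **Char-`2` pencil obstruction, computable form.**  If `2 = 0` in a nontrivial commutative ring `K`
and the first-factor pencil of the integer tensor `t` has determinant a unit of `K` at some integer
point, then `P ⋭ t` over `K`. -/
theorem not_sThree_polyDegeneratesTo_of_pencilDetInt (K : Type*) [CommRing K] [Nontrivial K]
    (h2 : (2 : K) = 0) (t : Fin 3 → Fin 3 → Fin 3 → ℤ) (ν : Fin 3 → ℤ) (d : ℤ)
    (hdet : pencilDetInt t ν = d) (hd : IsUnit ((d : ℤ) : K)) :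
    ¬ PolyDegeneratesTo (sThree K) (fun a b c => ((t a b c : ℤ) : K)) := by
  refine not_polyDegeneratesTo_sThree_of_two_eq_zero K h2 _ (fun a => ((ν a : ℤ) : K)) ?_
  rw [pencilMatrix_cast, ← RingHom.map_det, ← pencilDetInt_eq_det, hdet, eq_intCast]
  exact hd.ne_zero

/-! ## Swapping the first two factors -/

/-- Degeneration is compatible with swapping the first two tensor factors on both sides. -/
theorem polyDegeneratesTo_swap₁₂ {K : Type*} [CommRing K] {ι κ μ ι' κ' μ' : Type*}
    [Fintype ι] [Fintype κ] [Fintype μ] {t : ι → κ → μ → K} {s : ι' → κ' → μ' → K}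
    (hts : PolyDegeneratesTo t s) :
    PolyDegeneratesTo (fun b a c => t a b c) (fun b a c => s a b c) := by
  obtain ⟨h, A, B, C, hd⟩ := hts
  refine ⟨h, B, A, C, fun b' a' c' j hj => ?_⟩
  have key : (∑ x, ∑ y, ∑ c, Polynomial.C (t y x c) * (B x b' * A y a' * C c c')) =
      ∑ a, ∑ b, ∑ c, Polynomial.C (t a b c) * (A a a' * B b b' * C c c') := by
    rw [Finset.sum_comm]
    exact Finset.sum_congr rfl fun a _ => Finset.sum_congr rfl fun b _ =>
      Finset.sum_congr rfl fun c _ => by ring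
  show (∑ x, ∑ y, ∑ c, Polynomial.C (t y x c) * (B x b' * A y a' * C c c')).coeff j =
    if j = h then s a' b' c' else 0
  rw [key]
  exact hd a' b' c' j hj

/-- `P` is symmetric under swapping the first two factors. -/
theorem sThree_swap₁₂ (K : Type*) [CommRing K] : (fun b a c => sThree K a b c) = sThree K := by
  have hInt : ∀ a b c, sThreeInt a b c = sThreeInt b a c := by decide
  funext b a c
  simp only [sThree, hInt a b c]

/-! ## The sixteen obstructed classes -/

/-- First-factor pencil determinants `±1` for fifteen normal forms (computations by `decide`). -/
theorem nurmiev_pencilDetInt_first :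
    pencilDetInt (nurmievInt 1) ![0, 1, 0] = -1 ∧ pencilDetInt (nurmievInt 2) ![1, 0, 1] = -1 ∧
    pencilDetInt (nurmievInt 3) ![1, 0, 0] = -1 ∧ pencilDetInt (nurmievInt 4) ![1, 0, 1] = -1 ∧
    pencilDetInt (nurmievInt 5) ![1, 1, 0] = 1 ∧ pencilDetInt (nurmievInt 6) ![1, 1, 0] = -1 ∧
    pencilDetInt (nurmievInt 7) ![1, 0, 0] = -1 ∧ pencilDetInt (nurmievInt 8) ![1, 1, 0] = -1 ∧
    pencilDetInt (nurmievInt 10) ![1, 0, 0] = -1 ∧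
    pencilDetInt (nurmievInt 12) ![1, 1, 0] = -1 ∧
    pencilDetInt (nurmievInt 13) ![1, 0, 0] = -1 ∧ pencilDetInt (nurmievInt 14) ![1, 0, 0] = 1 ∧
    pencilDetInt (nurmievInt 15) ![1, 1, 0] = 1 ∧ pencilDetInt (nurmievInt 16) ![1, 0, 0] = -1 ∧
    pencilDetInt (nurmievInt 22) ![1, 0, 0] = 1 := by
  decide

/-- Second-factor pencil of `N₁₁` (its first-factor pencil cubic vanishes identically). -/
theorem nurmiev_11_pencilDetInt_second :
    pencilDetInt (fun a b c => nurmievInt 11 b a c) ![1, 1, 0] = -1 := by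
  decide

/-- `((-1 : ℤ) : K)` is a unit. -/
private theorem isUnit_cast_neg_one (K : Type*) [CommRing K] : IsUnit (((-1 : ℤ) : ℤ) : K) := by
  simp

/-- `((1 : ℤ) : K)` is a unit. -/
private theorem isUnit_cast_one (K : Type*) [CommRing K] : IsUnit (((1 : ℤ) : ℤ) : K) := by
  simp

/-- **`P ⋭ N₁₁` in characteristic `2`** (the class of `T_{U₂}`; via the factor swap). -/
theorem not_sThree_polyDegeneratesTo_nurmiev_11_of_two_eq_zero (K : Type*) [CommRing K]
    [Nontrivial K] (h2 : (2 : K) = 0) : ¬ PolyDegeneratesTo (sThree K) (nurmiev K 11) := by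
  intro h
  have h' := polyDegeneratesTo_swap₁₂ h
  rw [sThree_swap₁₂] at h'
  exact not_sThree_polyDegeneratesTo_of_pencilDetInt K h2 (fun a b c => nurmievInt 11 b a c)
    ![1, 1, 0] (-1) nurmiev_11_pencilDetInt_second (isUnit_cast_neg_one K) h'

/-- **The sixteen `2`-adically obstructed classes.**  If `2 = 0` in a nontrivial commutative ring `K`,
then `P ⋭ N_k` over `K` for `k ∈ {1,2,3,4,5,6,7,8,10,11,12,13,14,15,16,22}`. -/
theorem not_sThree_polyDegeneratesTo_nurmiev_of_mem_of_two_eq_zero (K : Type*) [CommRing K]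
    [Nontrivial K] (h2 : (2 : K) = 0) (k : ℕ)
    (hk : k ∈ ({1, 2, 3, 4, 5, 6, 7, 8, 10, 11, 12, 13, 14, 15, 16, 22} : Finset ℕ)) :
    ¬ PolyDegeneratesTo (sThree K) (nurmiev K k) := by
  obtain ⟨h1, h2', h3, h4, h5, h6, h7, h8, h10, h12, h13, h14, h15, h16, h22⟩ :=
    nurmiev_pencilDetInt_first
  simp only [Finset.mem_insert, Finset.mem_singleton] at hk
  rcases hk with rfl | rfl | rfl | rfl | rfl | rfl | rfl | rfl | rfl | rfl | rfl | rfl | rfl | rfl |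
      rfl | rfl
  · exact not_sThree_polyDegeneratesTo_of_pencilDetInt K h2 _ _ _ h1 (isUnit_cast_neg_one K)
  · exact not_sThree_polyDegeneratesTo_of_pencilDetInt K h2 _ _ _ h2' (isUnit_cast_neg_one K)
  · exact not_sThree_polyDegeneratesTo_of_pencilDetInt K h2 _ _ _ h3 (isUnit_cast_neg_one K)
  · exact not_sThree_polyDegeneratesTo_of_pencilDetInt K h2 _ _ _ h4 (isUnit_cast_neg_one K)
  · exact not_sThree_polyDegeneratesTo_of_pencilDetInt K h2 _ _ _ h5 (isUnit_cast_one K)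
  · exact not_sThree_polyDegeneratesTo_of_pencilDetInt K h2 _ _ _ h6 (isUnit_cast_neg_one K)
  · exact not_sThree_polyDegeneratesTo_of_pencilDetInt K h2 _ _ _ h7 (isUnit_cast_neg_one K)
  · exact not_sThree_polyDegeneratesTo_of_pencilDetInt K h2 _ _ _ h8 (isUnit_cast_neg_one K)
  · exact not_sThree_polyDegeneratesTo_of_pencilDetInt K h2 _ _ _ h10 (isUnit_cast_neg_one K)
  · exact not_sThree_polyDegeneratesTo_nurmiev_11_of_two_eq_zero K h2
  · exact not_sThree_polyDegeneratesTo_of_pencilDetInt K h2 _ _ _ h12 (isUnit_cast_neg_one K)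
  · exact not_sThree_polyDegeneratesTo_of_pencilDetInt K h2 _ _ _ h13 (isUnit_cast_neg_one K)
  · exact not_sThree_polyDegeneratesTo_of_pencilDetInt K h2 _ _ _ h14 (isUnit_cast_one K)
  · exact not_sThree_polyDegeneratesTo_of_pencilDetInt K h2 _ _ _ h15 (isUnit_cast_one K)
  · exact not_sThree_polyDegeneratesTo_of_pencilDetInt K h2 _ _ _ h16 (isUnit_cast_neg_one K)
  · exact not_sThree_polyDegeneratesTo_of_pencilDetInt K h2 _ _ _ h22 (isUnit_cast_one K)

/-! ## Three classes below `P` over every ring -/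

/-- `P ⊵ N₂₃ = e₀e₀e₀ + e₀e₁e₁` by restricting the slice `P(0,·,·) = e₁e₂ + e₂e₁` (order `0`,
multiplier `1`). -/
theorem sThree_nurmiev_23_unit_check :
    DegenCert.check 3 3 3 3 3 3 0 1 sThreeInt (nurmievInt 23)
      ![![[1], [], []], ![[], [], []], ![[], [], []]]
      ![![[], [], []], ![[1], [], []], ![[], [1], []]]
      ![![[], [], []], ![[], [1], []], ![[1], [], []]] = true := by
  decide +kernel

/-- `P ⊵ N₂₄ = e₀e₀e₀` by restriction (order `0`, multiplier `1`). -/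
theorem sThree_nurmiev_24_unit_check :
    DegenCert.check 3 3 3 3 3 3 0 1 sThreeInt (nurmievInt 24)
      ![![[1], [], []], ![[], [], []], ![[], [], []]]
      ![![[], [], []], ![[1], [], []], ![[], [], []]]
      ![![[], [], []], ![[], [], []], ![[1], [], []]] = true := by
  decide +kernel

/-- **`P ⊵ N_k` over every commutative ring for `k ∈ {19, 23, 24}`** (multiplier-`1` certificates:
`sThree_nurmiev_19_check` of the boundary file and the two restrictions above). -/
theorem sThree_polyDegeneratesTo_nurmiev_of_mem_all_rings (K : Type*) [CommRing K] (k : ℕ)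
    (hk : k ∈ ({19, 23, 24} : Finset ℕ)) : PolyDegeneratesTo (sThree K) (nurmiev K k) := by
  simp only [Finset.mem_insert, Finset.mem_singleton] at hk
  rcases hk with rfl | rfl | rfl
  · exact DegenCert.polyDegeneratesTo_of_check_one K sThree_nurmiev_19_check
  · exact DegenCert.polyDegeneratesTo_of_check_one K sThree_nurmiev_23_unit_check
  · exact DegenCert.polyDegeneratesTo_of_check_one K sThree_nurmiev_24_unit_check

/-- **The characteristic-`2` shadow table (as far as decided).**  In a nontrivial commutative ring with
`2 = 0`: `P ⋭ N_k` for the sixteen classes with a unimodular pencil matrix, `P ⊵ N_k` for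
`k ∈ {19, 23, 24}` (and `{17, 20, 21}` in `SoloInformedCwTwoCharTwoRestrictions`); `N₉`, `N₁₈` are
obstructed only outside the kernel (rank of `Ω` modulo `2`). -/
theorem sThree_charTwo_shadow (K : Type*) [CommRing K] [Nontrivial K] (h2 : (2 : K) = 0) :
    (∀ k ∈ ({1, 2, 3, 4, 5, 6, 7, 8, 10, 11, 12, 13, 14, 15, 16, 22} : Finset ℕ),
        ¬ PolyDegeneratesTo (sThree K) (nurmiev K k)) ∧
      ∀ k ∈ ({19, 23, 24} : Finset ℕ), PolyDegeneratesTo (sThree K) (nurmiev K k) :=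
  ⟨fun k hk => not_sThree_polyDegeneratesTo_nurmiev_of_mem_of_two_eq_zero K h2 k hk,
    fun k hk => sThree_polyDegeneratesTo_nurmiev_of_mem_all_rings K k hk⟩

end Summit.MatrixMultiplication.MatrixMultiplication.Theorems
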